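import Summits.CriticalPhenomena.Ising3DConformalLimit.Theorems.ReflectionTwinExistsContinuousLimitReduction
import Summits.CriticalPhenomena.Ising3DConformalLimit.Theorems.ReflectionTwinExistsContinuousLimitClusterPointNondegenerate
import HarnessLib

/-!
# Item 4657 up to its sign clause ⟸ K1′ ALONE: every inversion-covariant (unknown weight) cluster point of the
# critical `ℤ³` zoom is non-degenerate and Möbius covariant (crux `ExistsContinuousLimit`, stmt-CriticalPhenomena-4582,
# line `Sketch`; registered sub-goal `clusterPointsMoebius_of_inversionCovariant`)

The landed reduction `clusterPointsMoebius_of_doubling_of_inversionCovariant` (p156070) used item 6150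
`TwoPointDoubling` only to make cluster points non-degenerate. That input is now a THEOREM:
`clusterPoint_isNondegenerateTwoPoint` (p156060 — axis log-convexity of `⟨σ₀σ_{ne₀}⟩_{β_c}` + Messager–Miracle-Solé,
no compactness). Hence K1′ alone — every normalised cluster point of the pinned zoom is covariant under the unit
inversion with SOME continuous positive weight (registered stub `stub_clusterPointInversionCovariant`, OPEN) — gives,
for every member `S` of the cluster set of item 4659, `IsNondegenerateTwoPoint S ∧ ∃ Δ, IsMoebiusCovariant Δ S`:
item 4657 `ClusterRigidity.ClusterPointsMoebius` up to its sign clause `0 < Δ`, BEFORE existence or compactness is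
known (translations/continuity of sequential limits are free, the landed K2 `stub_inversionBegetsDilation` p155681 turns
the weighted inversion into scale + inversion covariance with one `Δ`, item 4675 p86170 adds `O(3)`). [folklore]
-/

noncomputable section

namespace Summit.CriticalPhenomena.Ising3DConformalLimit.ReflectionTwinExistsContinuousLimit

open Literature.Probability.LatticeModels Filter Set
open scoped Topology
open Summit.CriticalPhenomena.Ising3DConformalLimit.MoebiusLimitExistsOnlyInteraction (rhoPin IsClusterPoint)
open Summit.CriticalPhenomena.Ising3DConformalLimit.Cruxes.ExistsScaleCovariantLimit.TwoHierarchies (continuousOn_seqLimit)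
open Summit.CriticalPhenomena.Ising3DConformalLimit.PrecisionLaplacianMoebiusLimitOfTwoPointLaw
  (stub_inversionBegetsRotations)

/-- **K1′ ⟹ every normalised cluster point of the pinned `ℤ³` zoom is non-degenerate and Möbius covariant with some
exponent `Δ`** — no compactness input (non-degeneracy is `clusterPoint_isNondegenerateTwoPoint`). [folklore] -/
theorem clusterPoint_moebius_of_inversionCovariant'
    (hK1 : ∀ S : CorrFamily 3, (∀ n z, z ∉ NonCoincident 3 n → S n z = 0) → IsClusterPoint S →
      ∃ w : EuclideanSpace ℝ (Fin 3) → ℝ, (∀ v, v ≠ 0 → 0 < w v) ∧ ContinuousOn w {0}ᶜ ∧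
        ∀ (n : ℕ) (x : Fin n → EuclideanSpace ℝ (Fin 3)), (∀ i, x i ≠ 0) →
          S n (fun i => EuclideanGeometry.inversion (0 : EuclideanSpace ℝ (Fin 3)) 1 (x i)) =
            (∏ i, w (x i)) * S n x)
    {S : CorrFamily 3} (hN : ∀ n z, z ∉ NonCoincident 3 n → S n z = 0) (hS : IsClusterPoint S) :
    IsNondegenerateTwoPoint S ∧ ∃ Δ : ℝ, IsMoebiusCovariant Δ S := by
  have hnd : IsNondegenerateTwoPoint S := clusterPoint_isNondegenerateTwoPoint S hS
  have htr : IsTranslationInvariant S := isTranslationInvariant_of_isClusterPoint hN hS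
  have hcont : ∀ n, ContinuousOn (S n) (NonCoincident 3 n) := by
    obtain ⟨u, hu, hconv⟩ := hS
    exact fun n => continuousOn_seqLimit hu (hconv n)
  obtain ⟨w, hwpos, hwcont, hcov⟩ := hK1 S hN hS
  obtain ⟨Δ, hsc, hinv⟩ := stub_inversionBegetsDilation S hN hcont htr hnd w hwpos hwcont hcov
  have hrot : IsRotationInvariant S := stub_inversionBegetsRotations Δ S htr hinv
  exact ⟨hnd, Δ, ⟨htr, hrot⟩, hsc, hinv⟩

/-- **Registered sub-goal `clusterPointsMoebius_of_inversionCovariant`: K1′ ALONE ⟹ every member of the cluster set of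
item 4659 is non-degenerate and Möbius covariant for some `Δ`** (item 4657 minus `0 < Δ`, unconditionally in the
compactness half). [folklore] -/
theorem clusterPointsMoebius_of_inversionCovariant :
    (∀ S : Literature.Probability.LatticeModels.CorrFamily 3,
      (∀ n z, z ∉ Literature.Probability.LatticeModels.NonCoincident 3 n → S n z = 0) →
      Summit.CriticalPhenomena.Ising3DConformalLimit.MoebiusLimitExistsOnlyInteraction.IsClusterPoint S →
      ∃ w : EuclideanSpace ℝ (Fin 3) → ℝ, (∀ v, v ≠ 0 → 0 < w v) ∧ ContinuousOn w {0}ᶜ ∧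
        ∀ (n : ℕ) (x : Fin n → EuclideanSpace ℝ (Fin 3)), (∀ i, x i ≠ 0) →
          S n (fun i => EuclideanGeometry.inversion (0 : EuclideanSpace ℝ (Fin 3)) 1 (x i)) =
            (∏ i, w (x i)) * S n x) →
    ∀ S : Literature.Probability.LatticeModels.CorrFamily 3,
      ((∀ n x, x ∉ Literature.Probability.LatticeModels.NonCoincident 3 n → S n x = 0) ∧
        ∃ u : ℕ → ℝ, (∀ k, u k ∈ Set.Ioc (0:ℝ) 1) ∧ Filter.Tendsto u Filter.atTop (nhds 0) ∧
          ∀ n, TendstoLocallyUniformlyOn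
            (fun k => Literature.Probability.LatticeModels.rescaledCorrelator
              (Literature.Probability.LatticeModels.criticalCorr 3)
              (fun δ : ℝ => (Literature.Probability.LatticeModels.criticalTwoPoint 3 (Pi.single 0 ⌊δ⁻¹⌋)) ^
                (-(1/2:ℝ))) n (u k))
            (S n) Filter.atTop (Literature.Probability.LatticeModels.NonCoincident 3 n)) →
      Literature.Probability.LatticeModels.IsNondegenerateTwoPoint S ∧
        ∃ Δ : ℝ, Literature.Probability.LatticeModels.IsMoebiusCovariant Δ S := by
  rintro hK1 S ⟨hN, u, hu1, hu, hconv⟩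
  exact clusterPoint_moebius_of_inversionCovariant' hK1 hN (isClusterPoint_of_mem hu1 hu hconv)

end Summit.CriticalPhenomena.Ising3DConformalLimit.ReflectionTwinExistsContinuousLimit

end
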